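import Summits.HubbardSuperconductivity.HubbardSuperconductivity.Theorems.BcsKacWindowCoherenceWindowLROEnergeticTransfer

/-!
# PROPOSED line skeleton `condensation-energy` for crux `CoherenceWindowLRO` (stmt-HubbardSuperconductivity-1319)

Written by the lead of line `birth` (prover-line-stmt-HubbardSuperconductivity-1319-c18-0) as a
RECOMMENDATION to crux-plan — not a filed line (leads do not file lines). ONE stub, the finite-volume
ENERGY export of a weak-coupling construction (condensation-energy comparison, Kac form); the composition is
the LANDED theorem
`Summit.HubbardSuperconductivity.HubbardSuperconductivity.Theorems.BcsKacWindow.coherenceWindowLRO_of_condensationEnergy`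
(p160483). `lean check`: rc 0, sorries 1 (= the stub), `CoherenceWindowLRO_of` concludes the crux BY NAME.

Why this shape rather than `PROPOSED_LINE_kato_window.lean` (c16): the stub below carries NO spectral data (no gap
`γ`, no coupling `ε`, no low-energy subspace `W`, no approximate eigenvectors) and NO ground-state quantifier: it
compares two sector ground ENERGIES per window torus, and the every-sector-ground-state conclusion of the crux is
produced by the variational principle inside the landed composition. It is the weakest typed sufficient condition
for the crux on record (dossier `Cruxes/CoherenceWindowLRO/ENERGETIC-c18.md`).

Honesty note: the stub is a genuine STRENGTHENING of the crux (the crux is equivalent to the per-torus first-order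
version, `coherenceWindowLRO_iff_pairSusceptibility`; here ONE `g` is fixed with the constants and the comparison is
at finite coupling), along the intended mechanism (BCS condensation energy `≈ N(0)Δ²/2` per site; `d`-wave channel
neutralised for `g ≳ g_eff(U) ~ U²` once `B₁g` strictly leads, stmt-0158). Its content is the `T = 0` ground-energy
density of the 2D Hubbard torus to absolute precision `o(e^{-2κ/U²})` per site — below
`Literature.Barriers.HubbardSuperconductivity.WeakCouplingCeiling`: `Leans on: stmt-HubbardSuperconductivity-2010
(open)` / its (M) child after the proposed split; co-requisite stmt-0158; apply the refuters' F1 restatement (Δ per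
doping) to the crux first — under F1 the stub's `Δ U` becomes `Δ δ U` and the composition is unchanged.
-/

set_option linter.dupNamespace false

namespace Summit.HubbardSuperconductivity.HubbardSuperconductivity.Cruxes.CoherenceWindowLRO.CondensationEnergy

open Summit.HubbardSuperconductivity.HubbardSuperconductivity.Theses.BcsKacWindow (CoherenceWindowLRO)
open Matrix Literature.MathematicalPhysics.QuantumLattice
open Summit.HubbardSuperconductivity.HubbardSuperconductivity.Theorems.BcsKacWindow

/-- **STUB — `stub_condensationEnergy` (the engine's energy export, Kac form).** There are a doping window
`[a,b] ⊂ (0,1/2)`, flat-in-`U` gap pins `e^{-κ₂/U²} ≤ Δ(U) ≤ e^{-κ₁/U²}`, `c₀, s₀ > 0` and ONE coupling `g > 0`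
such that for every window top `s ≥ s₀` there is `U₁ > 0` with: on every window torus (`δ ∈ [a,b]`,
`U ∈ (0,U₁)`, even `L`, `s₀ ≤ Δ(U)L ≤ s`), in the sector `K = szSector N 0` (`N = 2⌊(1-δ)L²/2⌋`),
`minEnergyOn (H + (g/L²)·Δ_d†Δ_d) K ≥ minEnergyOn H K + g·c₀·Δ(U)²·L²` (`H = hubbardTorus 2 L 1 U`): weakening
the `d_{x²-y²}` BCS channel by the Kac-normalised reduced repulsion `(g/L²)Δ_d†Δ_d` costs at least the condensation
energy `g·c₀Δ(U)²` per site.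
Why plausibly true: `d/dg minEnergyOn (H + (g/L²)Δ_d†Δ_d) K = L⁻²⟨Δ_d†Δ_d⟩_g ≈ m(g)²L²` with `m(g)` the `d`-wave order
parameter at reduced channel coupling `g_eff(U) − g`; integrating to `g ≳ g_eff ~ U²` gives the full condensation
energy `≈ N(0)Δ_BCS²L²/2`, so `c₀ ≈ N(0)/(2g)·(Δ_BCS/Δ)²`, uniform in `s`; `U₁` depends on `s` only through finite-size
corrections on tori of side `≤ s/Δ(U)`.
Size: XL = the `T = 0` weak-coupling engine below `WeakCouplingCeiling` (stmt-HubbardSuperconductivity-2010), as a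
two-sided bound on sector ground-energy densities at precision `o(Δ(U)²)` per site. -/
theorem stub_condensationEnergy :
    ∃ (a b κ₁ κ₂ c₀ s₀ g : ℝ) (Δ : ℝ → ℝ), 0 < a ∧ a < b ∧ b < 1 / 2 ∧ 0 < κ₁ ∧ κ₁ ≤ κ₂ ∧
      0 < c₀ ∧ 0 < s₀ ∧ 0 < g ∧
      (∀ U : ℝ, 0 < U → Real.exp (-(κ₂ / U ^ 2)) ≤ Δ U ∧ Δ U ≤ Real.exp (-(κ₁ / U ^ 2))) ∧
      ∀ s : ℝ, s₀ ≤ s → ∃ U₁ : ℝ, 0 < U₁ ∧ ∀ δ ∈ Set.Icc a b, ∀ U ∈ Set.Ioo (0 : ℝ) U₁,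
        ∀ (L : ℕ) [NeZero L], Even L → s₀ ≤ Δ U * L → Δ U * L ≤ s →
          (hubbardTorus 2 L 1 U).minEnergyOn
              (szSector (Λ := FermionTorus 2 L) (2 * ⌊(1 - δ) * (L : ℝ) ^ 2 / 2⌋₊) 0) +
            g * c₀ * Δ U ^ 2 * (L : ℝ) ^ 2 ≤
          (hubbardTorus 2 L 1 U +
              ((g / (L : ℝ) ^ 2 : ℝ) : ℂ) • ((pairField dWaveFormFactor L)ᴴ * pairField dWaveFormFactor L)).minEnergyOn
            (szSector (Λ := FermionTorus 2 L) (2 * ⌊(1 - δ) * (L : ℝ) ^ 2 / 2⌋₊) 0) := by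
  sorry

/-- **`CoherenceWindowLRO_of` — the skeleton theorem**: the stub implies the crux BY NAME through the landed
composition `coherenceWindowLRO_of_condensationEnergy` (sorry-free, p160483). -/
theorem CoherenceWindowLRO_of : CoherenceWindowLRO :=
  coherenceWindowLRO_of_condensationEnergy stub_condensationEnergy

end Summit.HubbardSuperconductivity.HubbardSuperconductivity.Cruxes.CoherenceWindowLRO.CondensationEnergy
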